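import Mathlib
import HarnessLib
import Literature.Computability.AlgebraicComplexity.ArithCircuit
import Literature.Computability.AlgebraicComplexity.SupportSymmetrisation
import Summits.ValiantsHypothesis.ValiantsHypothesis.Theorems.MonotoneRestorationMonotoneRestorationQPRowScanGates

/-!
# ValiantsHypothesis / MonotoneRestoration — `MonotoneRestorationQP`, line `Sketch`, D3 (part 2)

Support file for crux item `stmt-ValiantsHypothesis-15886`
(`Summit.ValiantsHypothesis.ValiantsHypothesis.Theses.MonotoneRestoration.MonotoneRestorationQP`),
line `Sketch`, stub `stub_rowScan_rowBlocks` (Theorem δ, the row blocks of the scan program):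
the three kinds of parts of a ROW of the scan program, as supported straight-line programs
(tree `ArithCircuit` gate lists with a support annotation), built with the bookkeeping of
`…QPRowScanGates.lean` for an ABSTRACT invariant `Inv` closed under the two extension rules
(`hcore`: append a gate with invariant value; `hhered`: append a gate with hereditary operands):

* `rowScanBlocks_powerSums` — the power sums `p_{d+1}(r_i) = Σ_j x_{ij}^{d+1}`, `d < D`, of row
  `i`: one product gate `x_{ij} ⋯ x_{ij}` (support `{i, j}`) per `(d, j)` and ONE sum gate over
  all `j` (support `{i}`; a full row sum is invariant under the permutations fixing `i`);
* `rowScanBlocks_aeval` — a sparse template `q ∈ F[z_0, …, z_{D-1}]` (`≤ T` monomials, degree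
  `≤ Eh`) evaluated at located values `P_0, …, P_{D-1}` of a common support `S₀`: one product gate
  `coeff · ∏ P_d^{μ d}` per monomial `μ` and one sum gate (all at support `S₀`, hereditary);
* `rowScanBlocks_matMul`, `rowScanBlocks_matPow` — the entries of `N · M` and of the powers
  `M^{k+1}`, `k ≤ m`, of `w × w` matrices of located values of a common support `S₀`
  (`w` product gates and one sum gate per entry, hereditary).

The list computation `rowScanBlocks_prod_flatten_replicate` is the registered sub-goal this file
discharges; the stub itself is proved in `…QPRowScanRowBlocks.lean`.

## References

* P. Bürgisser, *Completeness and Reduction in Algebraic Complexity Theory*, Springer 2000,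
  Def. 2.1 (straight-line programs).
-/

-- `Summit.ValiantsHypothesis.ValiantsHypothesis.…` is the tree's mandated single-conjunct layout
-- (Sub = Summit), so the duplicated namespace component is intended.
set_option linter.dupNamespace false

open Literature.Computability.AlgebraicComplexity MvPolynomial

namespace Summit.ValiantsHypothesis.ValiantsHypothesis.Theorems

/-! ### Two list computations -/

/-- `∏ (replicate (e 0) (x 0) ++ ⋯ ++ replicate (e (D-1)) (x (D-1))) = ∏_d x d ^ e d`. [folklore] -/
theorem rowScanBlocks_prod_flatten_replicate {M : Type*} [CommMonoid M] (D : ℕ) (e : Fin D → ℕ)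
    (x : Fin D → M) :
    ((List.ofFn fun d : Fin D => List.replicate (e d) (x d)).flatten).prod = ∏ d, x d ^ e d := by
  induction D with
  | zero => simp
  | succ D ih =>
    rw [List.ofFn_succ, List.flatten_cons, List.prod_append, List.prod_replicate,
      Fin.prod_univ_succ, ih]

/-- The members of `replicate (e 0) (x 0) ++ ⋯ ++ replicate (e (D-1)) (x (D-1))` are among the
`x d`. [folklore] -/
theorem rowScanBlocks_mem_flatten_replicate {α : Type*} {D : ℕ} {e : Fin D → ℕ} {x : Fin D → α}
    {a : α} (h : a ∈ (List.ofFn fun d : Fin D => List.replicate (e d) (x d)).flatten) :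
    ∃ d, a = x d := by
  obtain ⟨l, hl, hal⟩ := List.mem_flatten.1 h
  obtain ⟨d, rfl⟩ := List.mem_ofFn.1 hl
  exact ⟨d, List.eq_of_mem_replicate hal⟩

/-! ### The parts of a row, for an abstract invariant -/

section Blocks

variable {F : Type*} [CommSemiring F] {n : ℕ} (A : ℕ)
  (Inv : List (ArithCircuit.Gate F (Fin n × Fin n)) → (ℕ → Finset (Fin n)) → Prop)
  (hcore : ∀ (L : List (ArithCircuit.Gate F (Fin n × Fin n))) (K : ℕ → Finset (Fin n))
    (g : ArithCircuit.Gate F (Fin n × Fin n)) (S : Finset (Fin n)), Inv L K → g.args ≠ [] →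
    g.fanIn ≤ A → (∀ u ∈ g.args, u.RefsBelow L.length) → S.card ≤ 2 →
    (∀ us, g = .prod us → ∀ u ∈ us, SupportSymm.osupp K u ⊆ S) →
    (∀ σ : Equiv.Perm (Fin n), (∀ x ∈ S, σ x = x) →
      rename (fun pq : Fin n × Fin n => (σ pq.1, σ pq.2)) (g.eval (ArithCircuit.gateValues L)) =
        g.eval (ArithCircuit.gateValues L)) →
    Inv (L ++ [g]) (Function.update K L.length S))
  (hhered : ∀ (L : List (ArithCircuit.Gate F (Fin n × Fin n))) (K : ℕ → Finset (Fin n))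
    (g : ArithCircuit.Gate F (Fin n × Fin n)) (S : Finset (Fin n)), Inv L K → g.args ≠ [] →
    g.fanIn ≤ A → (∀ u ∈ g.args, u.RefsBelow L.length) → S.card ≤ 2 →
    (∀ u ∈ g.args, SupportSymm.osupp K u ⊆ S) → Inv (L ++ [g]) (Function.update K L.length S))

include hcore hhered in
/-- **Power sums of a row.** From `(L, K)` satisfying `Inv`, at most `D (n + 1)` more gates
locate every `p_{d+1}(r_i) = Σ_j x_{ij}^{d+1}`, `d < D`, at support `{i}`: for each `d`, one
product gate `x_{ij}^{d+1} = x_{ij} ⋯ x_{ij}` per `j` (fan-in `d + 1 ≤ D`, support `{i, j}`) and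
one sum gate over all `j` (fan-in `n + 1`, support `{i}`; invariant under the permutations fixing
`i` by reindexing the sum). [folklore] -/
theorem rowScanBlocks_powerSums (D : ℕ) (hAn : n + 1 ≤ A) (hAD : D ≤ A) (i : Fin n)
    (L : List (ArithCircuit.Gate F (Fin n × Fin n))) (K : ℕ → Finset (Fin n)) (hInv : Inv L K) :
    ∃ (L' : List (ArithCircuit.Gate F (Fin n × Fin n))) (K' : ℕ → Finset (Fin n)), L <+: L' ∧
      (∀ t < L.length, K' t = K t) ∧ L'.length ≤ L.length + D * (n + 1) ∧ Inv L' K' ∧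
      ∀ d : Fin D, ∃ t < L'.length, K' t = {i} ∧
        (ArithCircuit.gateValues L').getD t 0 =
          ∑ j : Fin n, (X (i, j) : MvPolynomial (Fin n × Fin n) F) ^ ((d : ℕ) + 1) := by
  have key := rowScanGates_iter (ι := Fin D) (β := Unit) Inv (fun _ _ => ({i} : Finset (Fin n)))
    (fun d _ => ∑ j : Fin n, (X (i, j) : MvPolynomial (Fin n × Fin n) F) ^ ((d : ℕ) + 1))
    (n + 1) L K ?_ hInv
  · obtain ⟨L', K', hpre, hagr, hlen, hInv', hfact⟩ := key
    exact ⟨L', K', hpre, hagr, by simpa using hlen, hInv', fun d => hfact d ()⟩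
  intro d L₁ K₁ _ _ hInv₁
  -- the powers `x_{ij}^{d+1}`, one product gate each
  obtain ⟨L₂, K₂, hpre₂, hagr₂, hlen₂, hInv₂, hpow⟩ := rowScanGates_iter (ι := Fin n) (β := Unit)
    Inv (fun j _ => ({i, j} : Finset (Fin n)))
    (fun j _ => (X (i, j) : MvPolynomial (Fin n × Fin n) F) ^ ((d : ℕ) + 1)) 1 L₁ K₁
    (fun j L' K' _ _ hInv' => by
      obtain ⟨hp, ha, hl, hlt, hK, hv⟩ := rowScanGates_append L' K'
        (.prod (List.replicate ((d : ℕ) + 1) (.var (i, j)))) ({i, j} : Finset (Fin n))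
      refine ⟨_, _, hp, ha, hl, hhered L' K' _ _ hInv' (by simp [ArithCircuit.Gate.args])
        ?_ ?_ Finset.card_le_two ?_, fun _ => ⟨L'.length, hlt, hK, ?_⟩⟩
      · simpa [ArithCircuit.Gate.fanIn, ArithCircuit.Gate.args] using le_trans d.2 hAD
      · intro u hu
        rw [List.eq_of_mem_replicate hu]
        trivial
      · intro u hu
        rw [List.eq_of_mem_replicate hu]
        simp [SupportSymm.osupp]
      · rw [hv]
        simp [ArithCircuit.Gate.eval, ArithCircuit.Operand.eval, List.prod_replicate])
    hInv₁
  choose tab htab using fun j => hpow j ()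
  -- the sum gate `Σ_j x_{ij}^{d+1}`
  obtain ⟨hp, ha, hl, hlt, hK, hv⟩ := rowScanGates_append L₂ K₂
    (.sum (((0 : F), .const 0) :: List.ofFn fun j : Fin n => ((1 : F), .gate (tab j))))
    ({i} : Finset (Fin n))
  have hval : (ArithCircuit.Gate.sum (((0 : F), .const 0) ::
      List.ofFn fun j : Fin n => ((1 : F), .gate (tab j)))).eval (ArithCircuit.gateValues L₂) =
      ∑ j : Fin n, (X (i, j) : MvPolynomial (Fin n × Fin n) F) ^ ((d : ℕ) + 1) := by
    simp only [ArithCircuit.Gate.eval, List.map_cons, List.map_ofFn, List.sum_cons, zero_smul,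
      zero_add, List.sum_ofFn, Function.comp_apply, one_smul, ArithCircuit.Operand.eval_gate]
    exact Finset.sum_congr rfl fun j _ => (htab j).2.2
  refine ⟨_, _, hpre₂.trans hp, fun t ht => ?_, by rw [Fintype.card_fin] at hlen₂; omega,
    hcore L₂ K₂ _ _ hInv₂ (by simp [ArithCircuit.Gate.args]) ?_ ?_
      ((Finset.card_singleton i).trans_le one_le_two) (by rintro us ⟨⟩) ?_,
    fun _ => ⟨L₂.length, hlt, hK, by rw [hv, hval]⟩⟩
  · rw [ha t (lt_of_lt_of_le ht hpre₂.length_le), hagr₂ t ht]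
  · simpa [ArithCircuit.Gate.fanIn, ArithCircuit.Gate.args] using hAn
  · intro u hu
    simp only [ArithCircuit.Gate.args, List.map_cons, List.map_ofFn, List.mem_cons,
      List.mem_ofFn, Function.comp_apply] at hu
    rcases hu with rfl | ⟨j, rfl⟩
    · trivial
    · exact (htab j).1
  · intro σ hσ
    have hσi : σ i = i := hσ i (Finset.mem_singleton_self i)
    rw [hval]
    simp only [map_sum, map_pow, rename_X, hσi]
    exact Equiv.sum_comp σ (fun j => (X (i, j) : MvPolynomial (Fin n × Fin n) F) ^ ((d : ℕ) + 1))

include hhered in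
/-- **A sparse template at located values.** If `P_0, …, P_{D-1}` are located in `(L, K)` at a
common support `S₀` (`|S₀| ≤ 2`) and `q ∈ F[z_0, …, z_{D-1}]` has `≤ T` monomials and degree
`≤ Eh`, then from any extension of `(L, K)` satisfying `Inv` at most `T + 1` more gates locate
`q(P_0, …, P_{D-1})` at support `S₀`: one product gate `coeff_μ · ∏_d P_d^{μ d}` per monomial `μ`
(fan-in `≤ Eh + 1`) and one sum gate (fan-in `≤ T + 1`), all hereditary. [folklore] -/
theorem rowScanBlocks_aeval {D T Eh : ℕ} (hAT : T + 1 ≤ A) (hAE : Eh + 1 ≤ A)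
    (S₀ : Finset (Fin n)) (hS₀ : S₀.card ≤ 2) (P : Fin D → MvPolynomial (Fin n × Fin n) F)
    (q : MvPolynomial (Fin D) F) (hT : q.support.card ≤ T) (hE : q.totalDegree ≤ Eh)
    (L : List (ArithCircuit.Gate F (Fin n × Fin n))) (K : ℕ → Finset (Fin n)) (ps : Fin D → ℕ)
    (hps : ∀ d, ps d < L.length ∧ K (ps d) = S₀ ∧ (ArithCircuit.gateValues L).getD (ps d) 0 = P d)
    (L' : List (ArithCircuit.Gate F (Fin n × Fin n))) (K' : ℕ → Finset (Fin n)) (hpre : L <+: L')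
    (hagr : ∀ t < L.length, K' t = K t) (hInv : Inv L' K') :
    ∃ (L'' : List (ArithCircuit.Gate F (Fin n × Fin n))) (K'' : ℕ → Finset (Fin n)), L' <+: L'' ∧
      (∀ t < L'.length, K'' t = K' t) ∧ L''.length ≤ L'.length + (T + 1) ∧ Inv L'' K'' ∧
      ∀ _y : Unit, ∃ t < L''.length, K'' t = S₀ ∧
        (ArithCircuit.gateValues L'').getD t 0 = aeval P q := by
  -- one product gate per monomial
  obtain ⟨L₂, K₂, hpre₂, hagr₂, hlen₂, hInv₂, hmon⟩ := rowScanGates_iter (ι := ↥q.support)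
    (β := Unit) Inv (fun _ _ => S₀) (fun μ _ => aeval P (monomial μ.1 (coeff μ.1 q))) 1 L' K'
    (fun μ L₁ K₁ hpre₁ hagr₁ hInv₁ => by
      have hps₁ : ∀ d, ps d < L₁.length ∧ K₁ (ps d) = S₀ ∧
          (ArithCircuit.gateValues L₁).getD (ps d) 0 = P d := fun d =>
        ⟨lt_of_lt_of_le (hps d).1 (hpre.trans hpre₁).length_le,
          by rw [hagr₁ _ (lt_of_lt_of_le (hps d).1 hpre.length_le), hagr _ (hps d).1, (hps d).2.1],
          by rw [rowScanGates_getD_eq_of_prefix (hpre.trans hpre₁) (hps d).1, (hps d).2.2]⟩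
      obtain ⟨hp, ha, hl, hlt, hK, hv⟩ := rowScanGates_append L₁ K₁
        (.prod (.const (coeff μ.1 q) ::
          (List.ofFn fun d : Fin D => List.replicate (μ.1 d) (.gate (ps d))).flatten)) S₀
      refine ⟨_, _, hp, ha, hl, hhered L₁ K₁ _ _ hInv₁ (by simp [ArithCircuit.Gate.args]) ?_ ?_
        hS₀ ?_, fun _ => ⟨L₁.length, hlt, hK, ?_⟩⟩
      · -- fan-in `1 + |μ| ≤ Eh + 1`
        have hdeg : (μ.1.sum fun _ e => e) ≤ Eh := (le_totalDegree μ.2).trans hE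
        rw [Finsupp.sum_fintype _ _ fun _ => rfl] at hdeg
        simp only [ArithCircuit.Gate.fanIn, ArithCircuit.Gate.args, List.length_cons,
          List.length_flatten, List.map_ofFn, List.sum_ofFn, Function.comp_apply,
          List.length_replicate]
        omega
      · intro u hu
        rcases List.mem_cons.1 hu with rfl | hu
        · trivial
        · obtain ⟨d, rfl⟩ := rowScanBlocks_mem_flatten_replicate hu
          exact (hps₁ d).1
      · intro u hu
        rcases List.mem_cons.1 hu with rfl | hu
        · simp [SupportSymm.osupp]
        · obtain ⟨d, rfl⟩ := rowScanBlocks_mem_flatten_replicate hu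
          exact (hps₁ d).2.1.le
      · rw [hv]
        simp only [ArithCircuit.Gate.eval, List.map_cons, List.prod_cons, List.map_flatten,
          List.map_ofFn, aeval_monomial, algebraMap_eq]
        rw [Finsupp.prod_fintype _ _ fun _ => pow_zero _]
        congr 1
        have h := rowScanBlocks_prod_flatten_replicate D μ.1
          (fun d => (ArithCircuit.Operand.gate (ps d) : ArithCircuit.Operand F (Fin n × Fin n)).eval
            (ArithCircuit.gateValues L₁))
        simp only [Function.comp_def, List.map_replicate]
        rw [h]
        exact Finset.prod_congr rfl fun d _ => by rw [ArithCircuit.Operand.eval_gate, (hps₁ d).2.2])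
    hInv
  choose mon hmon using fun μ => hmon μ ()
  -- the sum gate over the monomials
  obtain ⟨hp, ha, hl, hlt, hK, hv⟩ := rowScanGates_append L₂ K₂
    (.sum (((0 : F), .const 0) ::
      (Finset.univ : Finset ↥q.support).toList.map fun μ => ((1 : F), .gate (mon μ)))) S₀
  refine ⟨_, _, hpre₂.trans hp, fun t ht => ?_, ?_,
    hhered L₂ K₂ _ _ hInv₂ (by simp [ArithCircuit.Gate.args]) ?_ ?_ hS₀ ?_,
    fun _ => ⟨L₂.length, hlt, hK, ?_⟩⟩
  · rw [ha t (lt_of_lt_of_le ht hpre₂.length_le), hagr₂ t ht]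
  · rw [Fintype.card_coe] at hlen₂
    omega
  · have h : (Finset.univ : Finset ↥q.support).toList.length ≤ T := by
      rw [Finset.length_toList, Finset.card_univ, Fintype.card_coe]; exact hT
    simp only [ArithCircuit.Gate.fanIn, ArithCircuit.Gate.args, List.map_cons, List.map_map,
      List.length_cons, List.length_map]
    omega
  · intro u hu
    simp only [ArithCircuit.Gate.args, List.map_cons, List.map_map, List.mem_cons, List.mem_map,
      Function.comp_apply] at hu
    rcases hu with rfl | ⟨μ, -, rfl⟩
    · trivial
    · exact (hmon μ).1
  · intro u hu
    simp only [ArithCircuit.Gate.args, List.map_cons, List.map_map, List.mem_cons, List.mem_map,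
      Function.comp_apply] at hu
    rcases hu with rfl | ⟨μ, -, rfl⟩
    · simp [SupportSymm.osupp]
    · exact (hmon μ).2.1.le
  · rw [hv]
    simp only [ArithCircuit.Gate.eval, List.map_cons, List.map_map, List.sum_cons, zero_smul,
      zero_add, Function.comp_def, one_smul, ArithCircuit.Operand.eval_gate, Finset.sum_map_toList]
    rw [Finset.sum_congr rfl fun μ _ => (hmon μ).2.2, Finset.sum_coe_sort q.support
      (fun μ => aeval P (monomial μ (coeff μ q))), ← map_sum, ← q.as_sum]

include hhered in
/-- **Matrix product of located matrices.** If the entries of `M` and `N` (`w × w`) are located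
in `(L, K)` at a common support `S₀` (`|S₀| ≤ 2`) and `Inv L K`, then at most `w² (w + 1)` more
gates locate the entries of `N · M` at support `S₀`: per entry, `w` product gates
`N_{ac} · M_{cb}` (fan-in `2`) and one sum gate (fan-in `w + 1`), all hereditary. [folklore] -/
theorem rowScanBlocks_matMul {w : ℕ} (hAw : w + 1 ≤ A) (hA2 : 2 ≤ A) (S₀ : Finset (Fin n))
    (hS₀ : S₀.card ≤ 2) (M N : Matrix (Fin w) (Fin w) (MvPolynomial (Fin n × Fin n) F))
    (L : List (ArithCircuit.Gate F (Fin n × Fin n))) (K : ℕ → Finset (Fin n))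
    (ent prev : Fin w → Fin w → ℕ)
    (hent : ∀ a b, ent a b < L.length ∧ K (ent a b) = S₀ ∧
      (ArithCircuit.gateValues L).getD (ent a b) 0 = M a b)
    (hprev : ∀ a b, prev a b < L.length ∧ K (prev a b) = S₀ ∧
      (ArithCircuit.gateValues L).getD (prev a b) 0 = N a b)
    (hInv : Inv L K) :
    ∃ (L' : List (ArithCircuit.Gate F (Fin n × Fin n))) (K' : ℕ → Finset (Fin n)), L <+: L' ∧
      (∀ t < L.length, K' t = K t) ∧ L'.length ≤ L.length + w * w * (w + 1) ∧ Inv L' K' ∧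
      ∀ ab : Fin w × Fin w, ∃ t < L'.length, K' t = S₀ ∧
        (ArithCircuit.gateValues L').getD t 0 = (N * M) ab.1 ab.2 := by
  have key := rowScanGates_iter (ι := Fin w × Fin w) (β := Unit) Inv (fun _ _ => S₀)
    (fun ab _ => (N * M) ab.1 ab.2) (w + 1) L K ?_ hInv
  · obtain ⟨L', K', hpre, hagr, hlen, hInv', hfact⟩ := key
    refine ⟨L', K', hpre, hagr, ?_, hInv', fun ab => hfact ab ()⟩
    simpa [Fintype.card_prod, Fintype.card_fin, mul_assoc] using hlen
  intro ab L₁ K₁ hpre₁ hagr₁ hInv₁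
  -- located entries persist
  have hloc : ∀ {t : ℕ} {v : MvPolynomial (Fin n × Fin n) F}
      {L₃ : List (ArithCircuit.Gate F (Fin n × Fin n))} {K₃ : ℕ → Finset (Fin n)},
      t < L.length ∧ K t = S₀ ∧ (ArithCircuit.gateValues L).getD t 0 = v → L₁ <+: L₃ →
      (∀ t < L₁.length, K₃ t = K₁ t) →
      t < L₃.length ∧ K₃ t = S₀ ∧ (ArithCircuit.gateValues L₃).getD t 0 = v := by
    rintro t v L₃ K₃ ⟨ht, hKt, hvt⟩ hpre₃ hagr₃
    exact ⟨lt_of_lt_of_le ht (hpre₁.trans hpre₃).length_le,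
      by rw [hagr₃ t (lt_of_lt_of_le ht hpre₁.length_le), hagr₁ t ht, hKt],
      by rw [rowScanGates_getD_eq_of_prefix (hpre₁.trans hpre₃) ht, hvt]⟩
  -- the products `N a c * M c b`
  obtain ⟨L₂, K₂, hpre₂, hagr₂, hlen₂, hInv₂, hpr⟩ := rowScanGates_iter (ι := Fin w) (β := Unit)
    Inv (fun _ _ => S₀) (fun c _ => N ab.1 c * M c ab.2) 1 L₁ K₁
    (fun c L' K' hpre' hagr' hInv' => by
      obtain ⟨h1, h2, h3⟩ := hloc (hprev ab.1 c) hpre' hagr'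
      obtain ⟨h1', h2', h3'⟩ := hloc (hent c ab.2) hpre' hagr'
      obtain ⟨hp, ha, hl, hlt, hK, hv⟩ := rowScanGates_append L' K'
        (.prod [.gate (prev ab.1 c), .gate (ent c ab.2)]) S₀
      refine ⟨_, _, hp, ha, hl, hhered L' K' _ _ hInv' (by simp [ArithCircuit.Gate.args])
        (by simpa [ArithCircuit.Gate.fanIn, ArithCircuit.Gate.args] using hA2) ?_ hS₀ ?_,
        fun _ => ⟨L'.length, hlt, hK, ?_⟩⟩
      · intro u hu
        simp only [ArithCircuit.Gate.args, List.mem_cons, List.not_mem_nil, or_false] at hu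
        rcases hu with rfl | rfl
        exacts [h1, h1']
      · intro u hu
        simp only [ArithCircuit.Gate.args, List.mem_cons, List.not_mem_nil, or_false] at hu
        rcases hu with rfl | rfl
        exacts [h2.le, h2'.le]
      · rw [hv]
        simp only [ArithCircuit.Gate.eval, List.map_cons, List.map_nil, List.prod_cons,
          List.prod_nil, mul_one, ArithCircuit.Operand.eval_gate, h3, h3'])
    hInv₁
  choose pr hpr using fun c => hpr c ()
  -- the sum gate `Σ_c N a c * M c b`
  obtain ⟨hp, ha, hl, hlt, hK, hv⟩ := rowScanGates_append L₂ K₂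
    (.sum (((0 : F), .const 0) :: List.ofFn fun c : Fin w => ((1 : F), .gate (pr c)))) S₀
  refine ⟨_, _, hpre₂.trans hp, fun t ht => ?_, by rw [Fintype.card_fin] at hlen₂; omega,
    hhered L₂ K₂ _ _ hInv₂ (by simp [ArithCircuit.Gate.args]) ?_ ?_ hS₀ ?_,
    fun _ => ⟨L₂.length, hlt, hK, ?_⟩⟩
  · rw [ha t (lt_of_lt_of_le ht hpre₂.length_le), hagr₂ t ht]
  · simpa [ArithCircuit.Gate.fanIn, ArithCircuit.Gate.args] using hAw
  · intro u hu
    simp only [ArithCircuit.Gate.args, List.map_cons, List.map_ofFn, List.mem_cons,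
      List.mem_ofFn, Function.comp_apply] at hu
    rcases hu with rfl | ⟨c, rfl⟩
    · trivial
    · exact (hpr c).1
  · intro u hu
    simp only [ArithCircuit.Gate.args, List.map_cons, List.map_ofFn, List.mem_cons,
      List.mem_ofFn, Function.comp_apply] at hu
    rcases hu with rfl | ⟨c, rfl⟩
    · simp [SupportSymm.osupp]
    · exact (hpr c).2.1.le
  · rw [hv]
    simp only [ArithCircuit.Gate.eval, List.map_cons, List.map_ofFn, List.sum_cons, zero_smul,
      zero_add, List.sum_ofFn, Function.comp_apply, one_smul, ArithCircuit.Operand.eval_gate,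
      Matrix.mul_apply]
    exact Finset.sum_congr rfl fun c _ => (hpr c).2.2

include hhered in
/-- **Matrix powers of a located matrix.** If the entries of `M` (`w × w`) are located in
`(L, K)` at a common support `S₀` and `Inv L K`, then at most `m · w² (w + 1)` more gates locate
the entries of `M^{k+1}` for all `k ≤ m` at support `S₀` (`M^{k+2} = M^{k+1} · M`,
`rowScanBlocks_matMul`). [folklore] -/
theorem rowScanBlocks_matPow {w : ℕ} (hAw : w + 1 ≤ A) (hA2 : 2 ≤ A) (S₀ : Finset (Fin n))
    (hS₀ : S₀.card ≤ 2) (M : Matrix (Fin w) (Fin w) (MvPolynomial (Fin n × Fin n) F))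
    (L : List (ArithCircuit.Gate F (Fin n × Fin n))) (K : ℕ → Finset (Fin n))
    (ent : Fin w → Fin w → ℕ)
    (hent : ∀ a b, ent a b < L.length ∧ K (ent a b) = S₀ ∧
      (ArithCircuit.gateValues L).getD (ent a b) 0 = M a b)
    (hInv : Inv L K) (m : ℕ) :
    ∃ (L' : List (ArithCircuit.Gate F (Fin n × Fin n))) (K' : ℕ → Finset (Fin n)), L <+: L' ∧
      (∀ t < L.length, K' t = K t) ∧ L'.length ≤ L.length + m * (w * w * (w + 1)) ∧ Inv L' K' ∧
      ∀ k ≤ m, ∀ a b : Fin w, ∃ t < L'.length, K' t = S₀ ∧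
        (ArithCircuit.gateValues L').getD t 0 = (M ^ (k + 1)) a b := by
  induction m with
  | zero =>
    refine ⟨L, K, List.prefix_rfl, fun t _ => rfl, by simp, hInv, fun k hk a b => ?_⟩
    obtain rfl : k = 0 := Nat.le_zero.mp hk
    exact ⟨ent a b, (hent a b).1, (hent a b).2.1, by rw [(hent a b).2.2, zero_add, pow_one]⟩
  | succ m ih =>
    obtain ⟨L₁, K₁, hpre₁, hagr₁, hlen₁, hInv₁, hfact₁⟩ := ih
    choose prev hprev using hfact₁ m le_rfl
    obtain ⟨L₂, K₂, hpre₂, hagr₂, hlen₂, hInv₂, hfact₂⟩ := rowScanBlocks_matMul A Inv hhered hAw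
      hA2 S₀ hS₀ M (M ^ (m + 1)) L₁ K₁ ent prev (fun a b => ⟨lt_of_lt_of_le (hent a b).1
        hpre₁.length_le, by rw [hagr₁ _ (hent a b).1, (hent a b).2.1],
        by rw [rowScanGates_getD_eq_of_prefix hpre₁ (hent a b).1, (hent a b).2.2]⟩) hprev hInv₁
    refine ⟨L₂, K₂, hpre₁.trans hpre₂, fun t ht => ?_, by rw [Nat.succ_mul]; omega, hInv₂,
      fun k hk a b => ?_⟩
    · rw [hagr₂ t (lt_of_lt_of_le ht hpre₁.length_le), hagr₁ t ht]
    · rcases Nat.lt_or_eq_of_le hk with hk | rfl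
      · obtain ⟨t, ht, hKt, hvt⟩ := hfact₁ k (Nat.lt_succ_iff.mp hk) a b
        exact ⟨t, lt_of_lt_of_le ht hpre₂.length_le, by rw [hagr₂ t ht, hKt],
          by rw [rowScanGates_getD_eq_of_prefix hpre₂ ht, hvt]⟩
      · obtain ⟨t, ht, hKt, hvt⟩ := hfact₂ (a, b)
        exact ⟨t, ht, hKt, by rw [hvt, pow_succ M (m + 1)]⟩

end Blocks

end Summit.ValiantsHypothesis.ValiantsHypothesis.Theorems
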